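import Mathlib
import HarnessLib
import Summits.ValiantsHypothesis.ValiantsHypothesis.Theorems.SymmetryDialShiftPerm

/-!
# SymmetryDial — kernel (θ₁): `per M_f mod 4` is decided by the hyperplane-section profile (part 3 of 3)

Route `route-ValiantsHypothesis-SymmetryDial`, item A₂ = `SymHardAffineSupported`
(stmt-ValiantsHypothesis-23711), instrument P′ = `SymmetryDialAffinePebble.AffinePebblePairs`.
Supporting kernel for the decomposition workshop (lineage decomp-val-lens-1, g7).

For a group matrix `M_f[x,y] = f(x+y)` over `𝔽₂^d` (support `S = {f = 1}`, `s = |S|`) the additive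
group acts on the nonzero terms `X = admissible M_f` of the permanent by conjugation with
translations.  Sorting `X` by translation-stabiliser:

* stabiliser `𝔽₂^d` (fixed points): exactly the translations `x ↦ x + t`, `t ∈ S` — `s` of them
  (`card_fixed`);
* stabiliser a hyperplane `ker ξ` (`ξ ≠ 0`): the `ker ξ`-equivariant terms are the SHIFT PERMUTATIONS
  of ordered pairs `(s₀,s₁) ∈ S²` with `ξ·s₀ = ξ·s₁` (`card_kerEqv`: `E(ξ) = k_ξ² + k'_ξ²`,
  `k_ξ = |S ∩ ker ξ| = kerCount f ξ`, `k'_ξ = s − k_ξ`), of which `s` are the fixed points;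
* every other term has stabiliser of codimension ≥ 2 (index-two subgroups are hyperplanes,
  `exists_kerSet_of_card`), hence an orbit of size divisible by `4` (`four_dvd_card_rest`).

Whence the exact decomposition `card_admissible_decomp` and

  **(θ₁)** `per M_f + (2^d − 1)s ≡ s + Σ_{ξ≠0} (k_ξ² + k'_ξ²)  (mod 4)` (`per_grpMat_modEq_four`).

Combined with (δ′) `kerCount_of_pebbleEquiv_three` (three pebble pairs force equal hyperplane-section
multisets) this gives `per_modEq_four_of_pebbleEquiv_three`: **`C³`-equivalent group matrices have
`per ≡ per (mod 4)`** — the census observation «per-gap ≡ 0 mod 4» is a theorem, and 2-adic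
certificates of depth ≤ 2 cannot separate any candidate pair for P′ among group matrices.
Also **(θ₀)** `per M_f ≡ |S| (mod 2)` (`per_grpMat_modEq_two`): equal-weight group matrices always
have permanents of equal parity.  (The same orbit argument one codimension deeper gives
`per mod 2^{j+1}` as a Möbius combination of the permanents of the `2^i × 2^i` coset-count group
matrices `N_K[c,c'] = |S ∩ (c+c'+K)|`, `codim K = i ≤ j`, with weights
`w(i) = Σ_{r ≤ j−i} (−1)^r 2^{r(r−1)/2} #{codim-r subspaces of 𝔽₂^{d−i}}`; only `j ≤ 1` is formalised.)
-/

set_option linter.dupNamespace false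

namespace Summit.ValiantsHypothesis.ValiantsHypothesis.Theorems.SymmetryDialPerModFour

open Finset Equiv
open SymmetryDialAffinePebble (V pair AffinePebbleEquiv)
open SymmetryDialAffinePebbleThree (grpMat kerCount kerCount_of_pebbleEquiv_three)
open SymmetryDialPerCongruence (admissible mem_admissible two_nsmul_eq_zero eval_perPoly_eq_card_admissible)
open SymmetryDialTranslationOrbits SymmetryDialShiftPerm

variable {d : ℕ}

/-- Every element of `Fin 2` is `0` or `1` (file-local copy of a two-line triviality). -/
private theorem fin2_cases (a : Fin 2) : a = 0 ∨ a = 1 := by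
  fin_cases a <;> simp

/-! ### 6. The orbit decomposition of `per M_f` and the congruence mod 4 -/

/-- Fixed points of the whole translation group inside `M_f` = translations by support vectors. -/
theorem card_fixed (f : V d → Bool) :
    ((admissible (grpMat f)).filter fun σ => stab σ = univ).card = (supp f).card := by
  refine card_bij' (fun σ _ => σ 0) (fun s _ => Equiv.addLeft s) ?_ ?_ ?_ ?_
  · intro σ hσ
    rw [mem_filter, mem_admissible] at hσ
    simp only [supp, mem_filter, mem_univ, true_and]
    simpa [grpMat] using hσ.1 0
  · intro s hs
    simp only [supp, mem_filter, mem_univ, true_and] at hs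
    rw [mem_filter, mem_admissible, stab_eq_univ_iff]
    refine ⟨fun i => ?_, fun t => Equiv.ext fun x => ?_⟩
    · simp only [grpMat, Equiv.coe_addLeft]
      rwa [add_assoc, two_nsmul_eq_zero, add_zero]
    · simp only [tconj_apply, Equiv.coe_addLeft]
      rw [show t + (s + (t + x)) = s + (t + (t + x)) by abel, add_add_cancel_left]
  · intro σ hσ
    rw [mem_filter, stab_eq_univ_iff] at hσ
    refine Equiv.ext fun x => ?_
    simp only [Equiv.coe_addLeft]
    have h := congrArg (fun τ : Perm (V d) => τ 0) (hσ.2 x)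
    simp only [tconj_apply, add_zero] at h
    rw [← h, add_comm x, add_assoc, two_nsmul_eq_zero, add_zero]
  · intro s hs
    simp

/-- `E(ξ) = #fixed + #{σ : stab σ = ker ξ}` (a stabiliser containing `ker ξ` is `ker ξ` or all). -/
theorem card_kerEqv_eq {f : V d → Bool} {ξ : V d} (hξ : ξ ≠ 0) :
    (kerEqv f ξ).card = ((admissible (grpMat f)).filter fun σ => stab σ = univ).card +
      ((admissible (grpMat f)).filter fun σ => stab σ = kerSet ξ).card := by
  rw [← card_union_of_disjoint]
  · congr 1
    ext σ
    simp only [kerEqv, mem_filter, mem_union]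
    constructor
    · rintro ⟨hX, hσ⟩
      have hsub : kerSet ξ ⊆ stab σ := fun t ht => mem_stab.2 (hσ t (mem_kerSet.1 ht))
      rcases stab_eq_or_univ hsub with h | h
      · exact Or.inr ⟨hX, h⟩
      · exact Or.inl ⟨hX, h⟩
    · rintro (⟨hX, h⟩ | ⟨hX, h⟩)
      · exact ⟨hX, fun t _ => (stab_eq_univ_iff.1 h) t⟩
      · exact ⟨hX, fun t ht => mem_stab.1 (by rw [h]; exact mem_kerSet.2 ht)⟩
  · rw [disjoint_left]
    intro σ h1 h2
    rw [mem_filter] at h1 h2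
    exact kerSet_ne_univ hξ (h2.2.symm.trans h1.2)

/-- The permutations whose stabiliser is neither everything nor a hyperplane come in orbits of size
divisible by four. -/
theorem four_dvd_card_rest (f : V d → Bool) :
    4 ∣ ((admissible (grpMat f)).filter fun σ =>
      ¬ (stab σ = univ ∨ ∃ ξ : V d, ξ ≠ 0 ∧ stab σ = kerSet ξ)).card := by
  set Z := (admissible (grpMat f)).filter fun σ =>
      ¬ (stab σ = univ ∨ ∃ ξ : V d, ξ ≠ 0 ∧ stab σ = kerSet ξ) with hZ
  have horb : ∀ σ ∈ Z, 4 ∣ (orb σ).card := by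
    intro σ hσ
    rw [hZ, mem_filter, not_or, not_exists] at hσ
    obtain ⟨j, hj, hcard⟩ := card_stab_pow σ
    have hprod := card_orb_mul_card_stab σ
    rw [hcard] at hprod
    have hjd : j ≠ d := by
      rintro rfl
      exact hσ.2.1 (eq_univ_of_card _ (by rw [hcard, card_V]))
    have hjd1 : j + 1 ≠ d := by
      intro h
      obtain ⟨ξ, hξ, hst⟩ := exists_kerSet_of_card (σ := σ) (by rw [hcard, ← pow_succ, h])
      exact hσ.2.2 ξ ⟨hξ, hst⟩
    obtain ⟨m, hm⟩ : ∃ m, d = j + 2 + m := ⟨d - j - 2, by omega⟩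
    have : (orb σ).card * 2 ^ j = (4 * 2 ^ m) * 2 ^ j := by
      rw [hprod, hm, pow_add, pow_add]; ring
    exact ⟨2 ^ m, mul_right_cancel₀ (pow_ne_zero j two_ne_zero) this⟩
  rw [card_eq_sum_card_image orb Z]
  refine dvd_sum fun O hO => ?_
  obtain ⟨σ₀, hσ₀, rfl⟩ := mem_image.1 hO
  have hfib : (Z.filter fun τ => orb τ = orb σ₀) = orb σ₀ := by
    ext τ
    rw [mem_filter]
    constructor
    · rintro ⟨-, h⟩
      rw [← h]
      exact self_mem_orb τ
    · intro hτ
      refine ⟨?_, orb_eq_of_mem hτ⟩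
      have h0 := hσ₀
      rw [hZ, mem_filter] at h0 ⊢
      refine ⟨orb_subset h0.1 hτ, ?_⟩
      rw [stab_eq_of_mem hτ]
      exact h0.2
  rw [hfib]
  exact horb σ₀ hσ₀

/-- **The orbit decomposition of `per M_f`** (exact, in `ℕ`):
`per M_f + (2^d − 1)·|S| = |S| + Σ_{ξ ≠ 0} (k_ξ² + k'_ξ²) + #Z` with `4 ∣ #Z`
(`Z` = permutations inside `M_f` whose translation-stabiliser has codimension ≥ 2). -/
theorem card_admissible_decomp (f : V d → Bool) :
    (admissible (grpMat f)).card + (2 ^ d - 1) * (supp f).card =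
      (supp f).card + (∑ ξ ∈ univ.erase (0 : V d), (kerCount f ξ ^ 2 + coKerCount f ξ ^ 2)) +
      ((admissible (grpMat f)).filter fun σ =>
        ¬ (stab σ = univ ∨ ∃ ξ : V d, ξ ≠ 0 ∧ stab σ = kerSet ξ)).card := by
  set X := admissible (grpMat f) with hX
  have h1 := (card_filter_add_card_filter_not
    (s := X) (fun σ => stab σ = univ ∨ ∃ ξ : V d, ξ ≠ 0 ∧ stab σ = kerSet ξ)).symm
  have h2 : (X.filter fun σ => stab σ = univ ∨ ∃ ξ : V d, ξ ≠ 0 ∧ stab σ = kerSet ξ) =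
      (X.filter fun σ => stab σ = univ) ∪
        (univ.erase (0 : V d)).biUnion (fun ξ => X.filter fun σ => stab σ = kerSet ξ) := by
    ext σ
    simp only [mem_filter, mem_union, mem_biUnion, mem_erase, mem_univ, and_true]
    constructor
    · rintro ⟨hx, h | ⟨ξ, hξ, h⟩⟩
      · exact Or.inl ⟨hx, h⟩
      · exact Or.inr ⟨ξ, hξ, hx, h⟩
    · rintro (⟨hx, h⟩ | ⟨ξ, hξ, hx, h⟩)
      · exact ⟨hx, Or.inl h⟩
      · exact ⟨hx, Or.inr ⟨ξ, hξ, h⟩⟩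
  have hdisj1 : Disjoint (X.filter fun σ => stab σ = univ)
      ((univ.erase (0 : V d)).biUnion fun ξ => X.filter fun σ => stab σ = kerSet ξ) := by
    rw [disjoint_left]
    intro σ ha hb
    rw [mem_filter] at ha
    obtain ⟨ξ, hξ, hb⟩ := mem_biUnion.1 hb
    rw [mem_filter] at hb
    exact kerSet_ne_univ (mem_erase.1 hξ).1 (hb.2.symm.trans ha.2)
  have hdisj2 : ((univ.erase (0 : V d)) : Set (V d)).PairwiseDisjoint
      (fun ξ => X.filter fun σ => stab σ = kerSet ξ) := by
    intro ξ _ ξ' _ hne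
    rw [Function.onFun, disjoint_left]
    intro σ ha hb
    rw [mem_filter] at ha hb
    exact hne (kerSet_injective (ha.2.symm.trans hb.2))
  have h3 : ∀ ξ ∈ univ.erase (0 : V d),
      (X.filter fun σ => stab σ = kerSet ξ).card + (supp f).card =
        kerCount f ξ ^ 2 + coKerCount f ξ ^ 2 := by
    intro ξ hξ
    have hξ0 : ξ ≠ 0 := (mem_erase.1 hξ).1
    rw [← card_kerEqv hξ0, card_kerEqv_eq hξ0, card_fixed, add_comm]
  rw [h1, h2, card_union_of_disjoint hdisj1, card_biUnion hdisj2, card_fixed, ← sum_congr rfl h3,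
    sum_add_distrib, sum_const, card_erase_of_mem (mem_univ _), card_univ, card_V, smul_eq_mul]
  ring

/-- **Lemma (θ₁): `per M_f mod 4` is a function of the hyperplane-section profile.**
`per M_f + (2^d − 1)|S| ≡ |S| + Σ_{ξ ≠ 0} (k_ξ² + k'_ξ²) (mod 4)`, `k_ξ = kerCount f ξ`,
`k'_ξ = |S| − k_ξ`. -/
theorem per_grpMat_modEq_four (f : V d → Bool) :
    (admissible (grpMat f)).card + (2 ^ d - 1) * (supp f).card ≡
      (supp f).card + ∑ ξ ∈ univ.erase (0 : V d), (kerCount f ξ ^ 2 + coKerCount f ξ ^ 2)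
      [MOD 4] := by
  obtain ⟨m, hm⟩ := four_dvd_card_rest f
  rw [Nat.ModEq, card_admissible_decomp, hm, Nat.add_mul_mod_self_left]


/-- **(θ₀)** `per M_f ≡ |S| (mod 2)`: the only orbits of odd size are the `|S|` fixed points.  In
particular two group matrices of EQUAL WEIGHT always have permanents of equal parity, so
`per mod 2` (`= det` over `𝔽₂`) certifies `per M_f ≠ per M_g` for no equal-weight pair. -/
theorem per_grpMat_modEq_two (f : V d → Bool) :
    (admissible (grpMat f)).card ≡ (supp f).card [MOD 2] := by
  have hdec := card_admissible_decomp f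
  obtain ⟨m, hm⟩ := four_dvd_card_rest f
  rw [hm] at hdec
  have h1 : ∀ a : ℕ, (a % 2) ^ 2 % 2 = a % 2 := by
    intro a
    rcases Nat.mod_two_eq_zero_or_one a with h | h <;> simp [h]
  have hterm : ∀ ξ : V d, (kerCount f ξ ^ 2 + coKerCount f ξ ^ 2) % 2 = (supp f).card % 2 := by
    intro ξ
    rw [← kerCount_add_coKerCount f ξ, Nat.add_mod, Nat.pow_mod, Nat.pow_mod (coKerCount f ξ), h1,
      h1, ← Nat.add_mod]
  have hsum : (∑ ξ ∈ univ.erase (0 : V d), (kerCount f ξ ^ 2 + coKerCount f ξ ^ 2)) % 2 =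
      ((2 ^ d - 1) * (supp f).card) % 2 := by
    rw [sum_nat_mod, sum_congr rfl (fun ξ _ => hterm ξ), sum_const, card_erase_of_mem (mem_univ _),
      card_univ, card_V, smul_eq_mul, Nat.mul_mod, Nat.mod_mod, ← Nat.mul_mod]
  generalize (2 ^ d - 1) * (supp f).card = a at hdec hsum
  generalize (∑ ξ ∈ univ.erase (0 : V d), (kerCount f ξ ^ 2 + coKerCount f ξ ^ 2)) = b at hdec hsum
  unfold Nat.ModEq
  omega

/-! ### 7. Three pebble pairs decide `per mod 4` for group matrices -/

/-- The profile sum as a function of `kerCount` alone. -/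
theorem coKerCount_eq (f : V d → Bool) (ξ : V d) : coKerCount f ξ = (supp f).card - kerCount f ξ := by
  have := kerCount_add_coKerCount f ξ; omega

/-- **`C³`-equivalent group matrices have congruent permanents mod 4.**  With
`kerCount_of_pebbleEquiv_three` (p754121): three pebble pairs on the affine matrix structures force
equal hyperplane-section multisets, hence — by (θ₁) — `per M_f ≡ per M_g (mod 4)`.  So a `2`-adic
certificate of depth ≤ 2 can never separate a `C³`-equivalent pair (census: `per ≡ 0 mod 4` throughout). -/
theorem per_modEq_four_of_pebbleEquiv_three (f g : V d → Bool)
    (h : AffinePebbleEquiv 3 d (grpMat f) (grpMat g)) :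
    (admissible (grpMat f)).card ≡ (admissible (grpMat g)).card [MOD 4] := by
  obtain ⟨η, hη⟩ := kerCount_of_pebbleEquiv_three f g h
  -- equal support sizes: `|S| = max_ξ kerCount`
  have hs : (supp f).card = (supp g).card := by
    apply le_antisymm
    · rw [← kerCount_zero_eq f, hη 0]; exact kerCount_le g _
    · rw [← kerCount_zero_eq g, ← η.apply_symm_apply 0, ← hη (η.symm 0)]; exact kerCount_le f _
  -- equal profile sums
  have hsum : ∑ ξ ∈ univ.erase (0 : V d), (kerCount f ξ ^ 2 + coKerCount f ξ ^ 2) =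
      ∑ ξ ∈ univ.erase (0 : V d), (kerCount g ξ ^ 2 + coKerCount g ξ ^ 2) := by
    have hf : ∀ ξ, kerCount f ξ ^ 2 + coKerCount f ξ ^ 2 =
        (fun k => k ^ 2 + ((supp g).card - k) ^ 2) (kerCount g (η ξ)) := fun ξ => by
      simp only [coKerCount_eq, hs, hη ξ]
    have hg : ∀ ξ, kerCount g ξ ^ 2 + coKerCount g ξ ^ 2 =
        (fun k => k ^ 2 + ((supp g).card - k) ^ 2) (kerCount g ξ) := fun ξ => by
      simp only [coKerCount_eq]
    have htot : ∑ ξ, (kerCount f ξ ^ 2 + coKerCount f ξ ^ 2) =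
        ∑ ξ, (kerCount g ξ ^ 2 + coKerCount g ξ ^ 2) := by
      simp_rw [hf, hg]
      exact Equiv.sum_comp η (fun ξ => (fun k => k ^ 2 + ((supp g).card - k) ^ 2) (kerCount g ξ))
    have h0 : kerCount f 0 ^ 2 + coKerCount f 0 ^ 2 = kerCount g 0 ^ 2 + coKerCount g 0 ^ 2 := by
      rw [coKerCount_eq, coKerCount_eq, kerCount_zero_eq, kerCount_zero_eq, hs]
    rw [← add_sum_erase univ _ (mem_univ (0 : V d)), ← add_sum_erase univ _ (mem_univ (0 : V d)),
      h0] at htot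
    exact Nat.add_left_cancel htot
  have hf := per_grpMat_modEq_four f
  have hg := per_grpMat_modEq_four g
  rw [hs, hsum] at hf
  exact Nat.ModEq.add_right_cancel' _ (hf.trans hg.symm)

/-- The same in `ZMod 4`, with the permanents named: `per M_f = #admissible M_f` by
`eval_perPoly_eq_card_admissible`, so for a `C³`-equivalent pair of group matrices the two (natural
number) permanents agree in `ZMod 4`. -/
theorem per_zmod_four_of_pebbleEquiv_three (f g : V d → Bool)
    (h : AffinePebbleEquiv 3 d (grpMat f) (grpMat g)) :
    ((admissible (grpMat f)).card : ZMod 4) = (admissible (grpMat g)).card :=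
  (ZMod.natCast_eq_natCast_iff _ _ _).2 (per_modEq_four_of_pebbleEquiv_three f g h)

end Summit.ValiantsHypothesis.ValiantsHypothesis.Theorems.SymmetryDialPerModFour
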